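import Literature.Geometry.Kaehler.ComplexTorusHodgeGroupHodgeCircleComplexPointsIff
import HarnessLib

/-!
# The parametrisations of the complex points on the Hodge-circle locus are BIJECTIVE: `ν : ℂ^× → Hg(X)(ℂ)`,
# `h_ℂ : ℂ^× × ℂ^× → MT(X)(ℂ)`, `(ℂ^×)^R → Hg(∏ₖ X_k)(ℂ)` and `{(z, w) : z_i w_i const} → MT(∏ₖ X_k)(ℂ)` are injective with the
# images computed in g35-#3/#4/#5 — `Hg(X)(ℂ) ≅ 𝔾_m(ℂ)`, `Hg(∏ₖ X_k)(ℂ) ≅ 𝔾_m(ℂ)^R`, one factor per `Hom`-class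
# (Moonen–Zarhin 1999 (2.2) «`Hg(X) = U_F`, `MT(X) = T_F`»; Imai 1976 §2, §3 Remarks; Moonen 2004 (3.2))

Layer `Literature/Geometry/Kaehler`, namespace `Literature.Geometry.Kaehler.ComplexTorus`; lane `lit-hodgefound`
(Track 2 foundations library), Layer A3/A4 (Hodge groups and Mumford–Tate groups; CM abelian varieties); prover seat
`lit-hodgefound-p17` (generation 35, self-proposed row g35-#8: the uniqueness half of the parametrisations of g35-#3–#5).
Sequel, BY NAME and without restating anything, of g35-#6 `ComplexTorusMumfordTateGroupHodgeCircleSigmaPiNonCMFactor`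
(`hodgeSC_eq_hodgeSC_iff`: `h_ℂ` injective in any dimension), of g35-#3/#4/#5 (`mem_hodgeGroupC_iff_exists_complexCircleHom_of_coe_hodgeGroup_eq_range`,
`mem_hodgeGroupC_sigmaPiPeriod_iff_exists_of_homColouring`, `mem_mumfordTateGroupC_sigmaPiPeriod_iff_exists_of_homColouring`)
and of g15/p06 (`sigmaBlockDiagSL_injective`, `sigmaBlockDiagGL_injective`). The tree's `complexCircleHom_injective` /
`hodgeSCGL_injective` (`ComplexTorusEllipticCurveHodgeGroupComplexPoints`) are the `2 × 2` cases, proved from the `(0,1)`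
entry; here any `ι ≠ ∅`. THEOREMS ONLY (no definition, no instance, no named fact; D-0026 net debt 0).

## Sources, verbatim

* B. Moonen, Yu. G. Zarhin, Math. Ann. 315 (1999), §2 (held `paper:arxiv-math_9901113`, p0005 L26–L49): "`U_F(R) =
  {x ∈ (F ⊗_ℚ R)^* | x x̄ = 1}` … Type IV(1,1): … `MT(X) = T_F` … `Hg(X) = U_F`"; §1 (p0002 L138–L141) "acting diagonally".
* H. Imai, Kōdai Math. Sem. Rep. 27 (1976), §2 (p. 368 L5–L7) "`Hg(E)` is a 1-dimensional torus"; §3 Remarks (p. 370 L31–L38)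
  "`Hg(A) = Δ_{m₁}(Hg(E₁)) × ⋯ × Δ_{m_k}(Hg(E_k))`".
* B. Moonen, *An introduction to Mumford–Tate groups* (2004), (3.2): "`S(ℂ) = ℂ^* × ℂ^*` … `h_ℂ`".

## What is proved (`[Nonempty ι]`; `ν_k = complexCircleHom (Ψ k)`, `h_{ℂ,k} = hodgeSCGL (Ψ k)`)

* §1 ONE TORUS: `hodgeSCGL_injective_of_nonempty`, `complexCircleHom_injective_of_nonempty`,
  `existsUnique_complexCircleHom_eq_of_coe_hodgeGroup_eq_range` (`M ∈ Hg(X)(ℂ)` on the locus is `ν(u)` for a UNIQUE `u`),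
  `existsUnique_hodgeSCGL_eq_of_coe_hodgeGroup_eq_range`.
* §2 PRODUCTS: `sigmaBlockDiagSL_complexCircleHom_comp_injective` (`u ↦ diag_k ν_k(u_{d(k)})` is injective on `(ℂ^×)^R` for `d`
  onto and `dim X_k > 0`), `existsUnique_sigmaBlockDiagSL_complexCircleHom_comp_eq_of_homColouring` (`Hg(∏ₖ X_k)(ℂ) ≅ (ℂ^×)^R`
  as a bijection), `sigmaBlockDiagGL_hodgeSCGL_comp_injective` (`(z, w) ↦ diag_k h_{ℂ,k}(z_{d(k)}, w_{d(k)})` injective).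

## References

* [MoonenZarhin1999LowDim] B. Moonen, Yu. Zarhin, Math. Ann. 315 (1999), §1, §2 (2.2), §3 Corollary.
* [Imai1976HodgeGroups] H. Imai, Kōdai Math. Sem. Rep. 27 (1976), §2 (p. 368), §3 Remarks (p. 370).
* [Moonen2004MT] B. Moonen (2004), (3.2).
-/

noncomputable section

open scoped Real
open Complex Module Matrix Function

namespace Literature.Geometry.Kaehler

namespace ComplexTorus

/-! ## §1 One torus: `h_ℂ` and `ν` are injective in any dimension -/

section One

variable {ι : Type*} [Fintype ι] [DecidableEq ι] {E : Type*} [NormedAddCommGroup E] [NormedSpace ℂ E]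
  (Φ : (ι → ℝ) ≃L[ℝ] E)

/-- **`h_ℂ : ℂ^× × ℂ^× →* GL(V_ℂ)` is injective** in any dimension (`ι ≠ ∅`; the tree's `hodgeSCGL_injective` is `2 × 2`).
[cite: Moonen2004MT, (3.2) ("`S(ℂ) = ℂ^* × ℂ^*`")] [cite: MoonenZarhin1999LowDim, §2 (2.2) ("`T_F`")] -/
theorem hodgeSCGL_injective_of_nonempty [Nonempty ι] : Function.Injective (hodgeSCGL Φ) := by
  intro p q h
  have h' := (hodgeSC_eq_hodgeSC_iff Φ).1 (congrArg (fun g : GL ι ℂ ↦ (g : Matrix ι ι ℂ)) h)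
  exact Prod.ext (Units.ext h'.1) (Units.ext h'.2)

/-- **`ν : ℂ^× →* SL(V_ℂ)` is injective** in any dimension (`ν(u) = h_ℂ(u, u⁻¹)`). [cite: MoonenZarhin1999LowDim, §2 (2.2) ("`U_F`")]
[cite: Moonen2004MT, (3.2)] -/
theorem complexCircleHom_injective_of_nonempty [Nonempty ι] : Function.Injective (complexCircleHom Φ) := by
  intro u v h
  have h' : hodgeSC Φ u u⁻¹ = hodgeSC Φ v v⁻¹ := by
    rw [hodgeSC_inv, hodgeSC_inv, ← coe_complexCircleHom, ← coe_complexCircleHom, h]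
  exact Units.ext ((hodgeSC_eq_hodgeSC_iff Φ).1 h').1

/-- **On the locus every `M ∈ Hg(X)(ℂ)` is `ν(u)` for a UNIQUE `u ∈ ℂ^×`**: `ν : ℂ^× → Hg(X)(ℂ)` is a bijection
(`Hg(X)(ℂ) ≅ 𝔾_m(ℂ) = U_F(ℂ)`). [cite: MoonenZarhin1999LowDim, §2 (2.2)] [cite: Imai1976HodgeGroups, §2 (p. 368 L5–L7)] -/
theorem existsUnique_complexCircleHom_eq_of_coe_hodgeGroup_eq_range [Nonempty ι]
    (h : (hodgeGroup Φ : Set (SpecialLinearGroup ι ℝ)) = Set.range (hodgeCircleSL Φ)) {M : SpecialLinearGroup ι ℂ}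
    (hM : M ∈ hodgeGroupC Φ) : ∃! u : ℂˣ, complexCircleHom Φ u = M := by
  obtain ⟨u, rfl⟩ := (mem_hodgeGroupC_iff_exists_complexCircleHom_of_coe_hodgeGroup_eq_range Φ h).1 hM
  exact ⟨u, rfl, fun v hv ↦ complexCircleHom_injective_of_nonempty Φ hv⟩

/-- **On the locus every `g ∈ MT(X)(ℂ)` is `h_ℂ(z, w)` for a UNIQUE pair** (`MT(X)(ℂ) ≅ 𝔾_m(ℂ)² = T_F(ℂ)`).
[cite: MoonenZarhin1999LowDim, §2 (2.2)] [cite: Moonen2004MT, (3.2)] -/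
theorem existsUnique_hodgeSCGL_eq_of_coe_hodgeGroup_eq_range [Nonempty ι]
    (h : (hodgeGroup Φ : Set (SpecialLinearGroup ι ℝ)) = Set.range (hodgeCircleSL Φ)) {g : GL ι ℂ}
    (hg : g ∈ mumfordTateGroupC Φ) : ∃! p : ℂˣ × ℂˣ, hodgeSCGL Φ p = g := by
  rw [mumfordTateGroupC_eq_range_hodgeSCGL_of_coe_hodgeGroup_eq_range Φ h] at hg
  obtain ⟨p, rfl⟩ := hg
  exact ⟨p, rfl, fun q hq ↦ hodgeSCGL_injective_of_nonempty Φ hq⟩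

end One

/-! ## §2 Products: one parameter per `Hom`-class, uniquely -/

section SigmaPi

variable {κ : Type*} [Fintype κ] [DecidableEq κ] {σ : κ → Type*} [∀ k, Fintype (σ k)] [∀ k, DecidableEq (σ k)]
  {F : κ → Type*} [∀ k, NormedAddCommGroup (F k)] [∀ k, NormedSpace ℂ (F k)] [∀ k, FiniteDimensional ℂ (F k)]
  (Ψ : ∀ k, (σ k → ℝ) ≃L[ℝ] F k) {R : Type*} [Fintype R] [DecidableEq R] {d : κ → R}

omit [Fintype κ] [DecidableEq κ] [∀ k, DecidableEq (σ k)] [Fintype R] [DecidableEq R] in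
/-- Positive-dimensional factors have non-empty index types (`|σ k| = 2 dim X_k`). [folklore] -/
private theorem nonempty_index_of_finrank_pos_param (Ψ : ∀ k, (σ k → ℝ) ≃L[ℝ] F k) (hg : ∀ k, 0 < finrank ℂ (F k))
    (k : κ) : Nonempty (σ k) := by
  rw [← Fintype.card_pos_iff, card_eq_two_mul_finrank (Ψ k)]
  exact Nat.mul_pos two_pos (hg k)

omit [Fintype R] [DecidableEq R] in
/-- **`u ↦ diag_k(ν_k(u_{d(k)}))` is injective on `(ℂ^×)^R`** (`d` onto, `dim X_k > 0`): block `k` with `d(k) = i` recovers `u_i`.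
[cite: Imai1976HodgeGroups, §3 Remarks (p. 370 L31–L38)] [cite: MoonenZarhin1999LowDim, §1 and §2 (2.2)] -/
theorem sigmaBlockDiagSL_complexCircleHom_comp_injective (hg : ∀ k, 0 < finrank ℂ (F k)) (hsurj : Surjective d) :
    Function.Injective fun u : R → ℂˣ ↦ sigmaBlockDiagSL σ ℂ fun k ↦ complexCircleHom (Ψ k) (u (d k)) := by
  haveI : ∀ k, Nonempty (σ k) := nonempty_index_of_finrank_pos_param Ψ hg
  intro u v huv
  funext i
  obtain ⟨k, rfl⟩ := hsurj i
  have hk := congrFun (sigmaBlockDiagSL_injective huv) k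
  exact complexCircleHom_injective_of_nonempty (Ψ k) hk

/-- **`Hg(∏ₖ X_k)(ℂ) ≅ (ℂ^×)^R` as a bijection: every `M ∈ Hg(∏ₖ X_k)(ℂ)` is `diag_k(ν_k(u_{d(k)}))` for a UNIQUE `u ∈ (ℂ^×)^R`**
(locus tori, `Hom`-colouring `d`). [cite: Imai1976HodgeGroups, §3 Remarks (p. 370 L31–L38)] [cite: MoonenZarhin1999LowDim, §1, §2 (2.2) and §3 Corollary] -/
theorem existsUnique_sigmaBlockDiagSL_complexCircleHom_comp_eq_of_homColouring (hg : ∀ k, 0 < finrank ℂ (F k))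
    (h : ∀ k, (hodgeGroup (Ψ k) : Set (SpecialLinearGroup (σ k) ℝ)) = Set.range (hodgeCircleSL (Ψ k)))
    (hd : ∀ k l, d k = d l ↔ homRat (Ψ k) (Ψ l) ≠ ⊥) (hsurj : Surjective d) {M : SpecialLinearGroup (Σ k, σ k) ℂ}
    (hM : M ∈ hodgeGroupC (sigmaPiPeriod Ψ)) :
    ∃! u : R → ℂˣ, sigmaBlockDiagSL σ ℂ (fun k ↦ complexCircleHom (Ψ k) (u (d k))) = M := by
  obtain ⟨u, rfl⟩ := (mem_hodgeGroupC_sigmaPiPeriod_iff_exists_of_homColouring Ψ hg h hd hsurj).1 hM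
  exact ⟨u, rfl, fun v hv ↦ sigmaBlockDiagSL_complexCircleHom_comp_injective Ψ hg hsurj hv⟩

omit [Fintype R] [DecidableEq R] in
/-- **`(z, w) ↦ diag_k(h_{ℂ,k}(z_{d(k)}, w_{d(k)}))` is injective on `(ℂ^×)^R × (ℂ^×)^R`** (`d` onto, `dim X_k > 0`).
[cite: MoonenZarhin1999LowDim, §2 (2.2) ("`T_F`")] [cite: Moonen2004MT, (3.2)] -/
theorem sigmaBlockDiagGL_hodgeSCGL_comp_injective (hg : ∀ k, 0 < finrank ℂ (F k)) (hsurj : Surjective d) :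
    Function.Injective fun zw : (R → ℂˣ) × (R → ℂˣ) ↦
      sigmaBlockDiagGL σ ℂ fun k ↦ hodgeSCGL (Ψ k) (zw.1 (d k), zw.2 (d k)) := by
  haveI : ∀ k, Nonempty (σ k) := nonempty_index_of_finrank_pos_param Ψ hg
  rintro ⟨z, w⟩ ⟨z', w'⟩ hzw
  have hi : ∀ i, z i = z' i ∧ w i = w' i := fun i ↦ by
    obtain ⟨k, rfl⟩ := hsurj i
    have hk := congrFun (sigmaBlockDiagGL_injective hzw) k
    exact Prod.mk.inj (hodgeSCGL_injective_of_nonempty (Ψ k) hk)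
  exact Prod.ext (funext fun i ↦ (hi i).1) (funext fun i ↦ (hi i).2)

/-- **Every `g ∈ MT(∏ₖ X_k)(ℂ)` is `diag_k(h_{ℂ,k}(z_{d(k)}, w_{d(k)}))` for a UNIQUE pair `(z, w)`** (which then has `z_i w_i`
constant): `MT(∏ₖ X_k)(ℂ) ≅ 𝔾_m^{R+1}` set-theoretically. [cite: MoonenZarhin1999LowDim, §2 (2.2) and §3 Corollary]
[cite: Moonen2004MT, (3.2) and §4 (4.6) Lemma] -/
theorem existsUnique_sigmaBlockDiagGL_hodgeSCGL_comp_eq_of_homColouring (hg : ∀ k, 0 < finrank ℂ (F k))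
    (h : ∀ k, (hodgeGroup (Ψ k) : Set (SpecialLinearGroup (σ k) ℝ)) = Set.range (hodgeCircleSL (Ψ k)))
    (hd : ∀ k l, d k = d l ↔ homRat (Ψ k) (Ψ l) ≠ ⊥) (hsurj : Surjective d) {g : GL (Σ k, σ k) ℂ}
    (hg' : g ∈ mumfordTateGroupC (sigmaPiPeriod Ψ)) :
    ∃! zw : (R → ℂˣ) × (R → ℂˣ), sigmaBlockDiagGL σ ℂ (fun k ↦ hodgeSCGL (Ψ k) (zw.1 (d k), zw.2 (d k))) = g := by
  obtain ⟨z, w, -, rfl⟩ := (mem_mumfordTateGroupC_sigmaPiPeriod_iff_exists_of_homColouring Ψ hg h hd hsurj).1 hg'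
  exact ⟨(z, w), rfl, fun q hq ↦ sigmaBlockDiagGL_hodgeSCGL_comp_injective Ψ hg hsurj hq⟩

end SigmaPi

end ComplexTorus

end Literature.Geometry.Kaehler

end
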